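import Literature.Probability.RandomPlanarGeometry.HexSAWPolygonCellsPolygonMoves
import HarnessLib

/-!
# XLVII — towards a STRICT step two: a single brick is a polygon, and the two-row rhombus (perimeter 14, top hexagon with three contacts)

Topic `Literature/Probability/RandomPlanarGeometry` (lane «pcv-sawmu», a-p4 g23; sequel of XVII `…Boundary` (`bdry`, `bond`), XVIII `…Corners` (`arcWalk`,
`isPath_arcWalk`, `bond_nbrDir`) and XIX `…PolygonMoves` (`isPolygon_bdry_insert`)).

First bricks of the witness family for the STRICT step two `q_N(ℍ) < q_{N+2}(ℍ)` (HANDOFF-gen23 §3, with XLVI `card_contacts_top_omegaImage_le_two`): every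
`(N+2)`-gon whose top hexagon has three contacts lies outside the image of OMEGA, and the smallest such polygon is the two-row rhombus
`{w, L w, LR w, LL w}` of perimeter `14`.
* ★ `bdry_singleton`, ★ `isPolygon_bdry_singleton` — the boundary of one brick is the hexagon 6-cycle (the base case every explicit cell-polygon construction in
  this series starts from; not in the tree before);
* `isPolygon_bdry_pair_lr`, ★ `isPolygon_bdry_rhombus`, `perim_rhombus` — `{w, LR w}`, `{w, LR w, L w}` and the rhombus `{w, LR w, L w, LL w}` are cell polygons
  of perimeters `10, 14, 14`, by XIX's insertion move; `rhombus_top_contacts` — `w` is the top hexagon of the rhombus and `L w, LL w, LR w` are all present.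

Sources: N. Madras, G. Slade, *The Self-Avoiding Walk* (1993), §3.2, Definition 3.2.1 and the proof of Theorem 3.2.3 [MadrasSlade1993]; I. Jensen, J. Phys.: Conf.
Ser. 42 (2006) 163, §2 (the smallest honeycomb polygons) [Jensen2006HoneycombPolygons]; I. G. Enting, I. Jensen, in *Polygons, Polyominoes and Polycubes*
(2009), §7.4.2 Fig. 7.10 (brick-wall form of the honeycomb lattice) [EntingJensen2009].  Label (lane): LANE INFRASTRUCTURE; nothing new in writing.
-/

open Finset

namespace Literature.Probability.RandomPlanarGeometry.SAW

namespace HexCell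

/-! ### One brick -/

/-- The boundary of a single brick consists of its six bonds. [cite: Jensen2006HoneycombPolygons, §2] -/
theorem bdry_singleton (c : Cell) : bdry {c} = (range 6).image fun j => bond c (nbrDir c (0 + j)) := by
  classical
  ext e
  rw [mem_bdry_iff, mem_image]
  constructor
  · rintro ⟨d, hd, x, hx, -, rfl⟩
    rw [mem_singleton] at hd; subst hd
    obtain ⟨i, hi, rfl⟩ := (mem_nbrs_iff_exists_nbrDir 0).1 hx
    exact ⟨i, mem_range.2 hi, rfl⟩
  · rintro ⟨i, -, rfl⟩
    refine ⟨c, mem_singleton_self _, nbrDir c (0 + i), nbrDir_mem_nbrs c _, ?_, rfl⟩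
    rw [mem_singleton]; intro h
    have := nbrDir_mem_nbrs c (0 + i)
    rw [h] at this
    exact self_notMem_nbrs c this

/-- ★ **A single brick is a cell polygon**: `bdry {c}` is the edge set of the hexagon 6-cycle `corner c 0 → corner c 1 → ⋯ → corner c 5 → corner c 0`.
[cite: MadrasSlade1993, Definition 3.2.1 (a polygon is the bond set of a self-avoiding cycle)] [cite: EntingJensen2009, §7.4.2, Fig. 7.10] -/
theorem isPolygon_bdry_singleton {c : Cell} (hc : Even (c.1 + c.2)) : IsPolygon brickWallGraph (bdry ({c} : Finset Cell)) := by
  classical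
  -- close the five-bond arc `corner 0 ⇝ corner 5` with the sixth bond `corner 5 – corner 6 = corner 0`
  have h6 : corner c (0 + 5 + 1) = corner c 0 := corner_eq_of_mod_eq c (by norm_num)
  have hadj : brickWallGraph.Adj (corner c (0 + 5)) (corner c 0) := h6 ▸ adj_corner_succ hc (0 + 5)
  refine ⟨corner c (0 + 5), SimpleGraph.Walk.cons hadj (arcWalk hc 0 5), ?_, ?_⟩
  · rw [SimpleGraph.Walk.cons_isCycle_iff]
    refine ⟨isPath_arcWalk hc 0 le_rfl, fun hmem => ?_⟩
    obtain ⟨j, hj, hje⟩ := (mem_edges_arcWalk hc).1 hmem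
    have e5 : s(corner c (0 + 5), corner c 0) = bond c (nbrDir c 5) := by rw [bond_nbrDir, ← h6]
    rw [e5] at hje
    have := nbrDir_injective_mod (bond_injOn c (nbrDir_mem_nbrs c 5) (nbrDir_mem_nbrs c (0 + j)) hje)
    omega
  · rw [SimpleGraph.Walk.edges_cons, List.toFinset_cons, edges_arcWalk_toFinset, bdry_singleton]
    have e5 : s(corner c (0 + 5), corner c 0) = bond c (nbrDir c (0 + 5)) := by rw [bond_nbrDir, ← h6]
    rw [e5]
    ext e
    simp only [mem_insert, mem_image, mem_range]
    constructor
    · rintro (rfl | ⟨j, hj, rfl⟩)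
      · exact ⟨5, by omega, rfl⟩
      · exact ⟨j, by omega, rfl⟩
    · rintro ⟨j, hj, rfl⟩
      by_cases hj5 : j = 5
      · subst hj5; exact Or.inl rfl
      · exact Or.inr ⟨j, by omega, rfl⟩

/-! ### The rhombus `{w, LR w, L w, LL w}` -/

/-- `{w, LR w}` is a cell polygon of perimeter `10`. [cite: MadrasSlade1993, §3.2 (proof of Theorem 3.2.3)] -/
theorem isPolygon_bdry_pair_lr {w : Cell} (hw : Even (w.1 + w.2)) :
    IsPolygon brickWallGraph (bdry ({LR w, w} : Finset Cell)) ∧ perim ({LR w, w} : Finset Cell) = 10 := by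
  classical
  have hbs : IsBrickSet ({w} : Finset Cell) := fun x hx => by rw [mem_singleton] at hx; subst hx; exact hw
  have hpar : Even ((LR w).1 + (LR w).2) := by simp only [LR_fst, LR_snd]; rw [Int.even_iff] at hw ⊢; omega
  have hnot : LR w ∉ ({w} : Finset Cell) := by
    rw [mem_singleton]; intro e; have := congrArg Prod.snd e; simp at this
  -- the contact arc of `LR w` in `{w}`: only `UL (LR w) = w`, i.e. direction 4 from `LR w`
  have harc : ∀ i < 6, nbrDir (LR w) (4 + i) ∈ ({w} : Finset Cell) ↔ i < 1 := by
    intro i hi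
    rw [mem_singleton]
    interval_cases i
    · rw [show nbrDir (LR w) (4 + 0) = UL (LR w) from rfl]
      exact ⟨fun _ => by omega, fun _ => Prod.ext (by simp) (by simp)⟩
    · rw [show nbrDir (LR w) (4 + 1) = L (LR w) from rfl]
      exact ⟨fun h => by have := congrArg Prod.snd h; simp only [L_snd, LR_snd] at this; omega, fun h => by omega⟩
    · rw [show nbrDir (LR w) (4 + 2) = LL (LR w) from rfl]
      exact ⟨fun h => by have := congrArg Prod.snd h; simp only [LL_snd, LR_snd] at this; omega, fun h => by omega⟩
    · rw [show nbrDir (LR w) (4 + 3) = LR (LR w) from rfl]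
      exact ⟨fun h => by have := congrArg Prod.snd h; simp only [LR_snd] at this; omega, fun h => by omega⟩
    · rw [show nbrDir (LR w) (4 + 4) = R (LR w) from rfl]
      exact ⟨fun h => by have := congrArg Prod.snd h; simp only [R_snd, LR_snd] at this; omega, fun h => by omega⟩
    · rw [show nbrDir (LR w) (4 + 5) = UR (LR w) from rfl]
      exact ⟨fun h => by have := congrArg Prod.fst h; simp only [UR_fst, LR_fst] at this; omega, fun h => by omega⟩
  have h1 : #(nbrs (LR w) ∩ {w}) = 1 := by
    rw [nbrs_inter_eq_image_of_arc (by norm_num) harc, card_image_of_injOn, card_range]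
    intro i hi j hj h
    have := nbrDir_injective_mod h
    simp only [coe_range, Set.mem_Iio] at hi hj; omega
  refine ⟨isPolygon_bdry_insert hbs hpar hnot (isPolygon_bdry_singleton hw) (a := 4) (m := 1) le_rfl (by norm_num)
    (by rw [perim_singleton]; norm_num) harc, ?_⟩
  rw [perim_insert_of_contacts_eq_one hnot h1, perim_singleton]

/-- `{w, LR w, L w}` is a cell polygon of perimeter `14` (`L w` touches `w` only). [cite: MadrasSlade1993, §3.2 (proof of Theorem 3.2.3)] -/
theorem isPolygon_bdry_triple {w : Cell} (hw : Even (w.1 + w.2)) :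
    IsPolygon brickWallGraph (bdry ({L w, LR w, w} : Finset Cell)) ∧ perim ({L w, LR w, w} : Finset Cell) = 14 := by
  classical
  obtain ⟨hP, hper⟩ := isPolygon_bdry_pair_lr hw
  have hbs : IsBrickSet ({LR w, w} : Finset Cell) := by
    intro x hx; simp only [mem_insert, mem_singleton] at hx
    rcases hx with rfl | rfl
    · simp only [LR_fst, LR_snd]; rw [Int.even_iff] at hw ⊢; omega
    · exact hw
  have hpar : Even ((L w).1 + (L w).2) := by simp only [L_fst, L_snd]; rw [Int.even_iff] at hw ⊢; omega
  have hnot : L w ∉ ({LR w, w} : Finset Cell) := by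
    simp only [mem_insert, mem_singleton, not_or]
    exact ⟨fun e => by have := congrArg Prod.snd e; simp only [L_snd, LR_snd] at this; omega,
      fun e => by have := congrArg Prod.fst e; simp only [L_fst] at this; omega⟩
  -- contact arc of `L w`: only `R (L w) = w` (direction 2)
  have harc : ∀ i < 6, nbrDir (L w) (2 + i) ∈ ({LR w, w} : Finset Cell) ↔ i < 1 := by
    intro i hi
    simp only [mem_insert, mem_singleton]
    interval_cases i
    · rw [show nbrDir (L w) (2 + 0) = R (L w) from rfl]
      exact ⟨fun _ => by omega, fun _ => Or.inr (Prod.ext (by simp) (by simp))⟩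
    · rw [show nbrDir (L w) (2 + 1) = UR (L w) from rfl]
      refine ⟨fun h => ?_, fun h => by omega⟩
      rcases h with h | h
      · have := congrArg Prod.snd h; simp only [UR_snd, L_snd, LR_snd] at this; omega
      · have := congrArg Prod.snd h; simp only [UR_snd, L_snd] at this; omega
    · rw [show nbrDir (L w) (2 + 2) = UL (L w) from rfl]
      refine ⟨fun h => ?_, fun h => by omega⟩
      rcases h with h | h
      · have := congrArg Prod.snd h; simp only [UL_snd, L_snd, LR_snd] at this; omega
      · have := congrArg Prod.snd h; simp only [UL_snd, L_snd] at this; omega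
    · rw [show nbrDir (L w) (2 + 3) = L (L w) from rfl]
      refine ⟨fun h => ?_, fun h => by omega⟩
      rcases h with h | h
      · have := congrArg Prod.fst h; simp only [L_fst, LR_fst] at this; omega
      · have := congrArg Prod.fst h; simp only [L_fst] at this; omega
    · rw [show nbrDir (L w) (2 + 4) = LL (L w) from rfl]
      refine ⟨fun h => ?_, fun h => by omega⟩
      rcases h with h | h
      · have := congrArg Prod.fst h; simp only [LL_fst, L_fst, LR_fst] at this; omega
      · have := congrArg Prod.fst h; simp only [LL_fst, L_fst] at this; omega
    · rw [show nbrDir (L w) (2 + 5) = LR (L w) from rfl]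
      refine ⟨fun h => ?_, fun h => by omega⟩
      rcases h with h | h
      · have := congrArg Prod.fst h; simp only [LR_fst, L_fst] at this; omega
      · have := congrArg Prod.snd h; simp only [LR_snd, L_snd] at this; omega
  have h1 : #(nbrs (L w) ∩ {LR w, w}) = 1 := by
    rw [nbrs_inter_eq_image_of_arc (by norm_num) harc, card_image_of_injOn, card_range]
    intro i hi j hj h
    have := nbrDir_injective_mod h
    simp only [coe_range, Set.mem_Iio] at hi hj; omega
  refine ⟨isPolygon_bdry_insert hbs hpar hnot hP (a := 2) (m := 1) le_rfl (by norm_num) (by rw [hper]; norm_num) harc, ?_⟩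
  rw [perim_insert_of_contacts_eq_one hnot h1, hper]

/-- ★ **The rhombus** `{LL w, L w, LR w, w}` is a cell polygon of perimeter `14` (`LL w` has the three consecutive contacts `LR w = R (LL w)`, `w = UR (LL w)`,
`L w = UL (LL w)`, so adding it does not change the perimeter). [cite: MadrasSlade1993, §3.2 (proof of Theorem 3.2.3)]
[cite: Jensen2006HoneycombPolygons, §2 (the honeycomb 14-gons)] -/
theorem isPolygon_bdry_rhombus {w : Cell} (hw : Even (w.1 + w.2)) :
    IsPolygon brickWallGraph (bdry ({LL w, L w, LR w, w} : Finset Cell)) ∧ perim ({LL w, L w, LR w, w} : Finset Cell) = 14 := by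
  classical
  obtain ⟨hP, hper⟩ := isPolygon_bdry_triple hw
  have hbs : IsBrickSet ({L w, LR w, w} : Finset Cell) := by
    intro x hx; simp only [mem_insert, mem_singleton] at hx
    rcases hx with rfl | rfl | rfl
    · simp only [L_fst, L_snd]; rw [Int.even_iff] at hw ⊢; omega
    · simp only [LR_fst, LR_snd]; rw [Int.even_iff] at hw ⊢; omega
    · exact hw
  have hpar : Even ((LL w).1 + (LL w).2) := by simp only [LL_fst, LL_snd]; rw [Int.even_iff] at hw ⊢; omega
  have hnot : LL w ∉ ({L w, LR w, w} : Finset Cell) := by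
    simp only [mem_insert, mem_singleton, not_or]
    exact ⟨fun e => by have := congrArg Prod.snd e; simp only [LL_snd, L_snd] at this; omega,
      fun e => by have := congrArg Prod.fst e; simp only [LL_fst, LR_fst] at this; omega,
      fun e => by have := congrArg Prod.snd e; simp only [LL_snd] at this; omega⟩
  -- contact arc of `LL w`: directions 2, 3, 4 (`R`, `UR`, `UL`) = `LR w`, `w`, `L w`
  have harc : ∀ i < 6, nbrDir (LL w) (2 + i) ∈ ({L w, LR w, w} : Finset Cell) ↔ i < 3 := by
    intro i hi
    simp only [mem_insert, mem_singleton]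
    interval_cases i
    · rw [show nbrDir (LL w) (2 + 0) = R (LL w) from rfl]
      exact ⟨fun _ => by omega, fun _ => Or.inr (Or.inl (Prod.ext (by simp; ring) (by simp)))⟩
    · rw [show nbrDir (LL w) (2 + 1) = UR (LL w) from rfl]
      exact ⟨fun _ => by omega, fun _ => Or.inr (Or.inr (Prod.ext (by simp) (by simp)))⟩
    · rw [show nbrDir (LL w) (2 + 2) = UL (LL w) from rfl]
      exact ⟨fun _ => by omega, fun _ => Or.inl (Prod.ext (by simp; ring) (by simp))⟩
    · rw [show nbrDir (LL w) (2 + 3) = L (LL w) from rfl]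
      refine ⟨fun h => ?_, fun h => by omega⟩
      rcases h with h | h | h
      · have := congrArg Prod.snd h; simp only [L_snd, LL_snd] at this; omega
      · have := congrArg Prod.fst h; simp only [L_fst, LL_fst, LR_fst] at this; omega
      · have := congrArg Prod.snd h; simp only [L_snd, LL_snd] at this; omega
    · rw [show nbrDir (LL w) (2 + 4) = LL (LL w) from rfl]
      refine ⟨fun h => ?_, fun h => by omega⟩
      rcases h with h | h | h
      · have := congrArg Prod.snd h; simp only [LL_snd, L_snd] at this; omega
      · have := congrArg Prod.snd h; simp only [LL_snd, LR_snd] at this; omega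
      · have := congrArg Prod.snd h; simp only [LL_snd] at this; omega
    · rw [show nbrDir (LL w) (2 + 5) = LR (LL w) from rfl]
      refine ⟨fun h => ?_, fun h => by omega⟩
      rcases h with h | h | h
      · have := congrArg Prod.snd h; simp only [LR_snd, LL_snd, L_snd] at this; omega
      · have := congrArg Prod.snd h; simp only [LR_snd, LL_snd] at this; omega
      · have := congrArg Prod.snd h; simp only [LR_snd, LL_snd] at this; omega
  have h3 : #(nbrs (LL w) ∩ {L w, LR w, w}) = 3 := by
    rw [nbrs_inter_eq_image_of_arc (by norm_num) harc, card_image_of_injOn, card_range]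
    intro i hi j hj h
    have := nbrDir_injective_mod h
    simp only [coe_range, Set.mem_Iio] at hi hj; omega
  refine ⟨isPolygon_bdry_insert hbs hpar hnot hP (a := 2) (m := 3) (by norm_num) (by norm_num) (by rw [hper]; norm_num) harc, ?_⟩
  have := perim_insert hnot; rw [h3, hper] at this; omega

/-- ★ In the rhombus the top hexagon is `w` and its three lower neighbours `L w`, `LL w`, `LR w` are all present — so by XLVI no OMEGA image is (a translate of)
the rhombus: the smallest witness for a strict step two at `N + 2 = 14`. [cite: MadrasSlade1993, §3.2 (proof of Theorem 3.2.3)] -/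
theorem rhombus_top_contacts (w : Cell) :
    IsLexmax ({LL w, L w, LR w, w} : Finset Cell) w ∧ L w ∈ ({LL w, L w, LR w, w} : Finset Cell) ∧
      LL w ∈ ({LL w, L w, LR w, w} : Finset Cell) ∧ LR w ∈ ({LL w, L w, LR w, w} : Finset Cell) := by
  refine ⟨⟨by simp, fun x hx => ?_⟩, by simp, by simp, by simp⟩
  simp only [mem_insert, mem_singleton] at hx
  rcases hx with rfl | rfl | rfl | rfl
  · left; simp
  · right; simp
  · left; simp
  · right; exact ⟨rfl, le_rfl⟩

end HexCell

end Literature.Probability.RandomPlanarGeometry.SAW
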